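import Summits.QuantumFields.YangMills.Theorems.IR.AfPincerUcXCovFemtoTemperedPrep

/-!
# Crux `IR` (stmt-QuantumFields-19354), line `af-pincer`, X-side (lane (1)A): the asymptotic-freedom WINDOW from the
# TEMPERED femto conditional package — the exterior-uniform hypotheses only on a GOOD set of exteriors, the bad set rare

Fourth file of `Theorems/IR/AfPincerUcXCovFemto{,Sharp,TemperedPrep,Tempered}` (seat ym-19354-afpincer-s2, generation 3; tools in `…TemperedPrep`).  `covWindow_of_femtoAF`
(`…XCovFemto`) takes E1-osc and CondCovAF for EVERY exterior of the femto cube.  Exterior-UNIFORM cube statements are exposed to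
exteriors that force a smooth background through the cube (abelian intuition: the harmonic extension of constant boundary curvature does
not decay; whether non-abelian screening restores `d⁻⁴` is the question the crux-disprover seat `ym-cdisprove-19353-penetration` is deciding
numerically for `FBL` / E1-osc).  The `NT` desk hedged its torus transfer accordingly (`Reference.abs_torusCov_sub_torusE_kerCov_le_on`,
`Theorems/BalabanLadderNTReferenceTorusTempered`: oscillations only on a measurable GOOD set of exteriors, the complement paid by its mass under
Wilson's measure).  THIS FILE is the same hedge for the X-side:

**`covWindow_of_temperedFemtoAF`** — for a positive map `u`, a physical collar `κ`, a femto range `ℓ > 2κ`, and measurable GOOD sets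
`Good β c b ⊆ LGConfig` (one per coupling and femto cube): E1-osc ON GOOD (`|kerE^η(A_x) − kerE^{η′}(A_x)| ≤ C₁/depth⁴` for `η, η′ ∈ Good`,
physical depth `≥ κ`), CondCovAF ON GOOD (`‖y−x‖⁸ |kerCov^η(A_x,A_y)| ≤ W′` at physical separation `≤ s′(W′)`, `η ∈ Good`) and HYPERSCALING
RARITY of the bad set («for every `D > 0`, for all large `β`, every femto cube and every torus holding it: `μ_{β,L}(lift ∉ Good β c b) ≤ D·u(β)⁸`»
— `o(u⁸)`, the precision the window asks at its far end; physically the bad exteriors are those inducing a background `≳ u²` per plaquette in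
the cube, whose total action is `≳ u⁻²`, so their mass is below any power of `u`) ⇒ generation 2's WINDOW (body verbatim) at scale `1/u`.
Per pair (`femto_pair_bound_on`): the tempered law of total covariance `|Cov_L − E_L[kerCov^{lift}]| ≤ (h_x + 2Mδ)(h_y + 2Mδ) + 4M²δ`
(`NT` desk) and `|E_L[kerCov^{lift}]| ≤ V + 2M²δ` (`abs_integral_le_of_abs_le_on`).  At `Good = univ`, `δ = 0` everything reduces to
`…XCovFemto`.

HONEST FRAMING.  A kernel REDUCTION; the three hypotheses are OPEN statements about 4-d non-abelian lattice gauge theory at weak coupling;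
nothing here proves asymptotic freedom, mixing or a gap; one open gap-crux of a CONDITIONAL chain (Track A 0/28 UV); not Clay.
No `sorry`; axioms ⊆ {propext, Classical.choice, Quot.sound}.
-/

set_option autoImplicit false

noncomputable section

open Filter Topology Finset MeasureTheory
open scoped BigOperators SchwartzMap
open Literature.MathematicalPhysics.QuantumFieldTheory hiding ZdEdge
open Literature.MathematicalPhysics.QuantumLattice
open Literature.Probability.LatticeModels (Site box mem_box)
open Summit.QuantumFields.YangMills.Cruxes.OSLegsFromFemtoAndGap.DlrCollarTransfer
open Summit.QuantumFields.YangMills.Cruxes.IR.AfOnset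

namespace Summit.QuantumFields.YangMills.Cruxes.IR.AfPincerUc

variable {G : Type} [Group G] [TopologicalSpace G] [IsTopologicalGroup G] [CompactSpace G]
  [MeasurableSpace G] [BorelSpace G]

/-! ## §4 The WINDOW at scale `1/u` from the TEMPERED femto conditional package -/
section Window

/-- **The asymptotic-freedom WINDOW from the TEMPERED femto conditional package.**  A positive map `u`, a physical collar `κ > 0`, a
femto range `ℓ > 2κ`, `C₁ ≥ 0`, and measurable GOOD sets of exteriors `Good β c b`: (E1-osc ON GOOD) one-point exterior oscillation
`≤ C₁/depth⁴` between good exteriors at physical depth `≥ κ` on femto cubes; (CondCovAF ON GOOD) the conditional two-point amplitude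
`‖y−x‖⁸ |kerCov^η(A_x,A_y)| ≤ W′` for good `η` at lattice separation `≥ n₀`, physical depth `≥ κ`, physical separation `≤ s′(W′)`;
(RARITY, hyperscaling grade) for every `D > 0`, for all large `β`, every femto cube `(c, b)` and every torus `2L+1 ≥ b + 3`:
`μ_{β,L}(lift⁻¹ (Good β c b)ᶜ) ≤ D · u(β)⁸` — imply generation 2's WINDOW hypothesis (body verbatim) at scale `ℓ β = 1/u β`.
[kernel reduction; all three hypotheses OPEN] -/
theorem covWindow_of_temperedFemtoAF (r : LatticeRep G) (u : ℝ → ℝ) (hu : ∀ β, 0 < u β)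
    {κ ℓ C₁ : ℝ} (hκ : 0 < κ) (hκℓ : 2 * κ < ℓ) (hC₁ : 0 ≤ C₁)
    (Good : ℝ → (Fin 4 → ℤ) → ℕ → Set (LGConfig 4 G)) (hGm : ∀ β c b, MeasurableSet (Good β c b))
    (hE1 : ∃ β₁ : ℝ, ∀ β : ℝ, β₁ ≤ β → ∀ (c : Fin 4 → ℤ) (b : ℕ), (b : ℝ) * u β ≤ ℓ →
      ∀ η ∈ Good β c b, ∀ η' ∈ Good β c b, ∀ x : Fin 4 → ℤ, κ / u β ≤ (depth c b x : ℝ) →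
        |kerE G r β c b η (dens G r x) - kerE G r β c b η' (dens G r x)| ≤ C₁ / (depth c b x : ℝ) ^ 4)
    (hAF : ∃ n₀ : ℕ, ∀ W' : ℝ, 0 < W' → ∃ s' β' : ℝ, 0 < s' ∧ ∀ β : ℝ, β' ≤ β →
      ∀ (c : Fin 4 → ℤ) (b : ℕ), (b : ℝ) * u β ≤ ℓ → ∀ η ∈ Good β c b, ∀ x y : Fin 4 → ℤ,
        (n₀ : ℝ) ≤ ‖siteToE (y - x)‖ → κ / u β ≤ (depth c b x : ℝ) → κ / u β ≤ (depth c b y : ℝ) →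
          ‖siteToE (y - x)‖ * u β ≤ s' →
            ‖siteToE (y - x)‖ ^ 8 * |kerCov G r β c b η (dens G r x) (dens G r y)| ≤ W')
    (hrare : ∀ D : ℝ, 0 < D → ∃ βD : ℝ, ∀ β : ℝ, βD ≤ β → ∀ (c : Fin 4 → ℤ) (b : ℕ), (b : ℝ) * u β ≤ ℓ →
      ∀ L : ℕ, b + 3 ≤ 2 * L + 1 →
        (wilsonMeasure (d := 4) (L := 2 * L + 1) r.ρ β).real ((torusLift (2 * L + 1)) ⁻¹' Good β c b)ᶜ ≤ D * u β ^ 8) :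
    ∀ W : ℝ, 0 < W → ∃ T' β₀ : ℝ, 0 < T' ∧ ∀ β : ℝ, β₀ ≤ β → ∀ᶠ L : ℕ in atTop,
      ∀ x ∈ box 4 L, ∀ y ∈ box 4 L, ‖x - y‖ ≤ (L : ℝ) → T' * ‖x - y‖ ≤ 1 / u β →
        |torusE G r β L (fun U => dens G r x U * dens G r y U) -
            torusE G r β L (dens G r x) * torusE G r β L (dens G r y)| ≤ W / (1 + ‖x - y‖) ^ 8 := by
  intro W hW
  obtain ⟨β₁, H1⟩ := hE1
  obtain ⟨n₀, hAF⟩ := hAF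
  -- the bound on the action density
  obtain ⟨M, hM0, hM⟩ := StubLower.exists_abs_dens_le G r
  -- the tree's volume-uniform weak-coupling bound (near pairs)
  obtain ⟨Wc, hWc0, hWc⟩ := exists_abs_torusCov_dens_le r
  -- the conditional AF clause at `W' = W / (2⁸ · 4)`
  obtain ⟨s', β', hs', H2⟩ := hAF (W / (2 ^ 8 * 4)) (by positivity)
  -- the boundary smallness parameter `εb ≤ 1`, `C₁² εb ≤ W/4`
  set εb : ℝ := min 1 (W / (4 * (C₁ ^ 2 + 1))) with hεb
  have hεb0 : 0 < εb := lt_min one_pos (by positivity)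
  have hεb1 : εb ≤ 1 := min_le_left _ _
  have hεbW : εb ≤ W / (4 * (C₁ ^ 2 + 1)) := min_le_right _ _
  have hℓκ : 0 < ℓ - 2 * κ := by linarith
  -- the window constant (as in the untempered proof, plus `T' ≥ 1` and `T' ≥ 1/κ`)
  set T' : ℝ := max (max (max (2 / s') (9 / (ℓ - 2 * κ))) (2 / (κ * εb))) (max 1 (1 / κ)) with hT'
  have hT's : 2 / s' ≤ T' := le_trans (le_trans (le_max_left _ _) (le_max_left _ _)) (le_max_left _ _)
  have hT'ℓ : 9 / (ℓ - 2 * κ) ≤ T' := le_trans (le_trans (le_max_right _ _) (le_max_left _ _)) (le_max_left _ _)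
  have hT'κ : 2 / (κ * εb) ≤ T' := le_trans (le_max_right _ _) (le_max_left _ _)
  have hT'1 : 1 ≤ T' := le_trans (le_max_left _ _) (le_max_right _ _)
  have hT'κ1 : 1 / κ ≤ T' := le_trans (le_max_right _ _) (le_max_right _ _)
  have hT'0 : 0 < T' := lt_of_lt_of_le one_pos hT'1
  -- the rarity demand
  set D : ℝ := min 1 (W * T' ^ 8 / (2 ^ 10 * (4 * M * C₁ + 10 * M ^ 2 + 1))) with hD
  have hD0 : 0 < D := lt_min one_pos (by positivity)
  have hD1 : D ≤ 1 := min_le_left _ _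
  have hDW : D ≤ W * T' ^ 8 / (2 ^ 10 * (4 * M * C₁ + 10 * M ^ 2 + 1)) := min_le_right _ _
  obtain ⟨βD, HD⟩ := hrare D hD0
  refine ⟨T', max (max (max β₁ β') βD) (max 1 (4 * Wc * ((n₀ : ℝ) + 2) ^ 8 / W)), hT'0, fun β hβ => ?_⟩
  have hβ₁ : β₁ ≤ β := le_trans (le_max_left _ _) (le_trans (le_max_left _ _) (le_trans (le_max_left _ _) hβ))
  have hβ' : β' ≤ β := le_trans (le_max_right _ _) (le_trans (le_max_left _ _) (le_trans (le_max_left _ _) hβ))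
  have hβD : βD ≤ β := le_trans (le_max_right _ _) (le_trans (le_max_left _ _) hβ)
  have hβ1 : 1 ≤ β := le_trans (le_max_left _ _) (le_trans (le_max_right _ _) hβ)
  have hβW : 4 * Wc * ((n₀ : ℝ) + 2) ^ 8 / W ≤ β := le_trans (le_max_right _ _) (le_trans (le_max_right _ _) hβ)
  have hβ0 : 0 < β := lt_of_lt_of_le one_pos hβ1
  have huβ : 0 < u β := hu β
  refine (Filter.eventually_ge_atTop (max 1 (⌈κ / u β⌉₊ + ⌈1 / (T' * u β)⌉₊ + 3))).mono
    fun L hL x _ y _ _ hwin => ?_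
  have hL1 : 1 ≤ L := le_trans (le_max_left _ _) hL
  have hLR : ⌈κ / u β⌉₊ + ⌈1 / (T' * u β)⌉₊ + 3 ≤ L := le_trans (le_max_right _ _) hL
  set t : ℝ := ‖x - y‖ with ht
  have ht0 : 0 ≤ t := norm_nonneg _
  have hpos : 0 < (1 + t) ^ 8 := by positivity
  by_cases hnear : t < max (n₀ : ℝ) 1
  · -- NEAR pairs: the tree bound (identical to the untempered proof)
    have hcov := hWc L hL1 β hβ1 x y
    have hq : Wc * (1 + Real.log β) ^ 2 / β ^ 2 ≤ 4 * Wc / β := by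
      rw [div_le_div_iff₀ (by positivity) hβ0]
      have hl := one_add_log_sq_le hβ1
      have h1 := mul_le_mul_of_nonneg_left hl hWc0
      have h2 := mul_le_mul_of_nonneg_right h1 hβ0.le
      calc Wc * (1 + Real.log β) ^ 2 * β ≤ Wc * (4 * β) * β := h2
        _ = 4 * Wc * β ^ 2 := by ring
    have hmax : max (n₀ : ℝ) 1 ≤ (n₀ : ℝ) + 1 := max_le (by linarith) (by
      have := (Nat.cast_nonneg n₀ : (0 : ℝ) ≤ n₀); linarith)
    have h1 : (1 + t) ^ 8 ≤ ((n₀ : ℝ) + 2) ^ 8 := pow_le_pow_left₀ (by positivity) (by linarith) 8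
    have hβW' : 4 * Wc / β ≤ W / ((n₀ : ℝ) + 2) ^ 8 := by
      rw [div_le_div_iff₀ hβ0 (by positivity)]
      have := (div_le_iff₀ hW).1 hβW
      linarith
    calc |torusE G r β L (fun U => dens G r x U * dens G r y U) -
            torusE G r β L (dens G r x) * torusE G r β L (dens G r y)|
        ≤ Wc * (1 + Real.log β) ^ 2 / β ^ 2 := hcov
      _ ≤ 4 * Wc / β := hq
      _ ≤ W / ((n₀ : ℝ) + 2) ^ 8 := hβW'
      _ ≤ W / (1 + t) ^ 8 := div_le_div_of_nonneg_left hW.le hpos h1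
  · -- FAR pairs: one femto cube around the pair, tempered transfer
    rw [not_lt] at hnear
    have ht1 : 1 ≤ t := le_trans (le_max_right _ _) hnear
    have htn : (n₀ : ℝ) ≤ t := le_trans (le_max_left _ _) hnear
    set E : ℝ := ‖siteToE (y - x)‖ with hE
    have htE : t ≤ E := norm_sub_le_norm_siteToE_sub x y
    have hEt : E ≤ 2 * t := norm_siteToE_sub_le_two_mul_norm_sub x y
    have hE1 : 1 ≤ E := ht1.trans htE
    have hE0 : 0 < E := lt_of_lt_of_le one_pos hE1
    -- units
    have hwin' : T' * t * u β ≤ 1 := by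
      have h := hwin
      rw [le_div_iff₀ huβ] at h
      exact h
    have htu : t * u β ≤ 1 / T' := by
      rw [le_div_iff₀ hT'0]
      calc t * u β * T' = T' * t * u β := by ring
        _ ≤ 1 := hwin'
    have hu1 : u β ≤ 1 / T' := by
      refine le_trans ?_ htu
      calc u β = 1 * u β := (one_mul _).symm
        _ ≤ t * u β := mul_le_mul_of_nonneg_right ht1 huβ.le
    have htT : t ≤ 1 / (T' * u β) := by
      rw [le_div_iff₀ (by positivity)]
      calc t * (T' * u β) = T' * t * u β := by ring
        _ ≤ 1 := hwin'
    -- the cube radius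
    set R : ℕ := ⌈κ / u β⌉₊ + ⌈t⌉₊ + 1 with hR
    have hR1 : 1 ≤ R := by omega
    have hκu : 0 < κ / u β := div_pos hκ huβ
    have hRge : κ / u β + t + 1 ≤ (R : ℝ) := by
      have h1 := Nat.le_ceil (κ / u β)
      have h2 := Nat.le_ceil t
      rw [hR]; push_cast; linarith
    have hRle : (R : ℝ) ≤ κ / u β + t + 3 := by
      have h1 := (Nat.ceil_lt_add_one hκu.le).le
      have h2 := (Nat.ceil_lt_add_one ht0).le
      rw [hR]; push_cast; linarith
    have hRL : R + 2 ≤ L := by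
      have : ⌈t⌉₊ ≤ ⌈1 / (T' * u β)⌉₊ := Nat.ceil_mono htT
      omega
    have hRL' : 2 * R + 1 + 3 ≤ 2 * L + 1 := by omega
    -- femto fit
    have h9 : 9 / T' ≤ ℓ - 2 * κ := by
      rw [div_le_iff₀ hT'0]
      have h := hT'ℓ
      rw [div_le_iff₀ hℓκ] at h
      linarith
    have hfem : ((2 * R + 1 : ℕ) : ℝ) * u β ≤ ℓ := by
      push_cast
      have h1 : (2 * (R : ℝ) + 1) * u β ≤ 2 * κ + 2 * (t * u β) + 7 * u β := by
        have : (2 * (R : ℝ) + 1) * u β ≤ (2 * (κ / u β + t + 3) + 1) * u β :=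
          mul_le_mul_of_nonneg_right (by linarith) huβ.le
        have e : (2 * (κ / u β + t + 3) + 1) * u β = 2 * κ + 2 * (t * u β) + 7 * u β := by
          field_simp
          ring
        linarith
      have h2 : 2 * (t * u β) + 7 * u β ≤ 9 / T' := by
        have : 9 / T' = 2 * (1 / T') + 7 * (1 / T') := by ring
        rw [this]
        exact add_le_add (by linarith) (by linarith)
      linarith
    -- depths
    have hdx : κ / u β ≤ (depth (fun j => x j - R) (2 * R + 1) x : ℝ) := by
      have h := StubLower.le_depth_cube x x R (t := 0) (fun j => by simp)
      linarith
    have hdy : κ / u β ≤ (depth (fun j => x j - R) (2 * R + 1) y : ℝ) := by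
      have h := StubLower.le_depth_cube x y R (t := t) (fun j => abs_cast_sub_le_norm_sub x y j)
      linarith
    have hyx : ∀ j, |y j - x j| + 1 ≤ (R : ℤ) := fun j => by
      have h1 : |((y j : ℤ) : ℝ) - x j| ≤ t := abs_cast_sub_le_norm_sub x y j
      have h2 : (((|y j - x j| : ℤ)) : ℝ) ≤ ((⌈t⌉₊ : ℕ) : ℝ) := by
        push_cast
        exact h1.trans (Nat.le_ceil t)
      have h3 : (|y j - x j| : ℤ) ≤ ((⌈t⌉₊ : ℕ) : ℤ) := by exact_mod_cast h2
      rw [hR]; push_cast; linarith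
    -- the rarity of the bad set of this cube on this torus
    set δ : ℝ := (wilsonMeasure (d := 4) (L := 2 * L + 1) r.ρ β).real
      ((torusLift (2 * L + 1)) ⁻¹' Good β (fun j => x j - R) (2 * R + 1))ᶜ with hδdef
    have hδ0 : 0 ≤ δ := measureReal_nonneg
    have hδD : δ ≤ D * u β ^ 8 := HD β hβD _ _ hfem L hRL'
    have hu1' : u β ≤ 1 := hu1.trans (by rw [div_le_one hT'0]; exact hT'1)
    have hδ1 : δ ≤ 1 := by
      refine hδD.trans ?_
      calc D * u β ^ 8 ≤ 1 * 1 ^ 8 := by gcongr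
        _ = 1 := by ring
    -- E1-osc on Good at the two sites: `h ≤ C₁ (uβ/κ)⁴ ≤ C₁`
    have hdiv : ∀ d : ℝ, κ / u β ≤ d → C₁ / d ^ 4 ≤ C₁ * (u β / κ) ^ 4 := fun d hd => by
      have hd0 : 0 < d := lt_of_lt_of_le hκu hd
      rw [div_eq_mul_inv]
      refine mul_le_mul_of_nonneg_left ?_ hC₁
      rw [← inv_pow, show u β / κ = (κ / u β)⁻¹ by rw [inv_div]]
      exact pow_le_pow_left₀ (inv_nonneg.2 hd0.le) ((inv_le_inv₀ hd0 hκu).2 hd) 4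
    have hhb0 : 0 ≤ C₁ * (u β / κ) ^ 4 := by positivity
    have huκ : u β / κ ≤ 1 := by
      rw [div_le_one hκ]
      calc u β ≤ 1 / T' := hu1
        _ ≤ κ := by
            rw [div_le_iff₀ hT'0]
            have h := hT'κ1
            rw [div_le_iff₀ hκ] at h
            linarith
    have hhbC : C₁ * (u β / κ) ^ 4 ≤ C₁ := by
      calc C₁ * (u β / κ) ^ 4 ≤ C₁ * 1 := mul_le_mul_of_nonneg_left (pow_le_one₀ (by positivity) huκ) hC₁
        _ = C₁ := mul_one _
    have hosc : ∀ z : Fin 4 → ℤ, κ / u β ≤ (depth (fun j => x j - R) (2 * R + 1) z : ℝ) →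
        ∀ η ∈ Good β (fun j => x j - R) (2 * R + 1), ∀ η' ∈ Good β (fun j => x j - R) (2 * R + 1),
        |kerE G r β (fun j => x j - R) (2 * R + 1) η (dens G r z) -
          kerE G r β (fun j => x j - R) (2 * R + 1) η' (dens G r z)| ≤ C₁ * (u β / κ) ^ 4 :=
      fun z hz η hη η' hη' => (H1 β hβ₁ _ _ hfem η hη η' hη' z hz).trans (hdiv _ hz)
    -- CondCovAF on Good: `|kerCov^η| ≤ (W/(2⁸·4))/E⁸`
    have hsep : E * u β ≤ s' := by
      have h2T : 2 / T' ≤ s' := by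
        rw [div_le_iff₀ hT'0]
        have h := hT's
        rw [div_le_iff₀ hs'] at h
        linarith
      calc E * u β ≤ 2 * t * u β := mul_le_mul_of_nonneg_right hEt huβ.le
        _ = 2 * (t * u β) := by ring
        _ ≤ 2 * (1 / T') := by linarith
        _ = 2 / T' := by ring
        _ ≤ s' := h2T
    have hV0 : 0 ≤ (W / (2 ^ 8 * 4)) / E ^ 8 := by positivity
    have hVG : ∀ η ∈ Good β (fun j => x j - R) (2 * R + 1),
        |kerCov G r β (fun j => x j - R) (2 * R + 1) η (dens G r x) (dens G r y)| ≤ (W / (2 ^ 8 * 4)) / E ^ 8 := by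
      intro η hη
      have h := H2 β hβ' _ _ hfem η hη x y (htn.trans htE) hdx hdy hsep
      rw [le_div_iff₀ (by positivity), mul_comm]
      exact h
    -- the tempered per-pair bound and the three numeric estimates
    have main := femto_pair_bound_on r β x y R L hRL hR1 hyx hM (hGm β _ _) hhb0 hhb0 hV0 (le_of_eq hδdef.symm)
      (hosc x hdx) (hosc y hdy) hVG
    have hAFterm : (W / (2 ^ 8 * 4)) / E ^ 8 ≤ (W / 4) / (1 + t) ^ 8 := femto_af_term_le hW.le (by norm_num) ht1 htE
    have hq2 : 2 / (T' * κ) ≤ εb := by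
      rw [div_le_iff₀ (by positivity)]
      have h := hT'κ
      rw [div_le_iff₀ (by positivity)] at h
      linarith
    have hBterm : C₁ * (u β / κ) ^ 4 * (C₁ * (u β / κ) ^ 4) ≤ (W / 4) / (1 + t) ^ 8 :=
      femto_boundary_term_le (by norm_num) hκ huβ ht0 hT'0 hεb0 hεb1 hεbW hq2 hu1 htu
    have hRterm := femto_rarity_term_le hM0 hC₁ hhbC hδ0 hδ1 hD0.le hδD hDW huβ hT'0 ht1 htT
    have hsum : (W / 4) / (1 + t) ^ 8 + (W / 4) / (1 + t) ^ 8 + (W / 4) / (1 + t) ^ 8 ≤ W / (1 + t) ^ 8 := by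
      have e : (W / 4) / (1 + t) ^ 8 + (W / 4) / (1 + t) ^ 8 + (W / 4) / (1 + t) ^ 8 = (3 * W / 4) / (1 + t) ^ 8 := by
        ring
      rw [e]
      exact div_le_div_of_nonneg_right (by linarith) hpos.le
    linarith

end Window

end Summit.QuantumFields.YangMills.Cruxes.IR.AfPincerUc

end
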